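/-
Copyright: lit-balaban reader/typer seat r18 (gen 27).  Statement-level skeleton of a published paper; no proof claims beyond what the
kernel checks below.
-/
import Literature.MathematicalPhysics.QuantumFieldTheory.BalabanImbrieJaffe1984to88.BIJ88Sect4Statements
import Literature.MathematicalPhysics.QuantumFieldTheory.BalabanImbrieJaffe1984to88.BIJ88Assoc575Torus
import Literature.MathematicalPhysics.QuantumFieldTheory.BalabanImbrieJaffe1984to88.BIJ88NeumannNoZeroModesTorus
import Literature.MathematicalPhysics.QuantumFieldTheory.Balaban1983to89.B3TorusRadialSums

/-!
# [BalabanImbrieJaffe1988] p. 274 — the tower of small-field regions `Λ_α^{(j)}`, the large-field regions `X_ω`, the collars of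
# width `r(e_j)` and the blocked regions `Λ̄_α^{(j)}`, typed WITH BODY on the tori of `Balaban1983to89.Setup`

T. Bałaban, J. Imbrie, A. Jaffe, *Effective action and cluster properties of the abelian Higgs model*, Commun. Math. Phys. **114** (1988)
257–315 [BalabanImbrieJaffe1988], Sect. 4 p. 274 [PDF 18], re-read first-hand on the render (poppler ×3) this session, verbatim:
*"Each X_ω is a union of r(e_{k−1})-cubes of the L^{−1}-lattice, and the X_ω's do not overlap. Each X_ω also specifies subsets
Λ_α^{(j)} ∩ X_ω for 0 ≦ j ≦ k−1, 0 ≦ α ≦ 13. These are unions of r(e_j)-cubes of the L^jη-lattice. These sets satisfy compatibility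
conditions arising from our constructions. In particular, with Λ_α^{(j)c} = ∪_ω (Λ_α^{(j)c} ∩ X_ω), we have Λ_0^{(j)} ⊂ Λ_{13}^{(j−1)} for
j ≧ 1. We have covered already the case j = 0, which is slightly different. For j ≧ 1, α = 1, …, 8, 11 the sets Λ_α^{(j)} are determined
by Λ_{α−1}^{(j)} by subtracting collar neighborhoods of width r(e_j) in the L^jη-lattice. We have Λ_α^{(j)} ⊂ Λ_{α−1}^{(j)}. The sets
Λ_{12}^{(j)}, Λ_{13}^{(j)} need not lose anything from Λ_{11}^{(j)}, Λ_{12}^{(j)}, though they may be smaller. The sets Λ_9^{(j)}, Λ_{10}^{(j)}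
lose a collar from Λ̃_8^{(j)}, Λ̃_9^{(j)}, which may be smaller than Λ_8^{(j)}, Λ_9^{(j)}. These sets will be defined below in a manner
analogous to that in the first step. We define Λ̄_α^{(j)} as the set in T_{L^{−j}} obtained as the union of L^j-blocks at the points of
Λ_α^{(j)}."*

statement-level skeleton of published theorems with citation tags; proofs where landed; nothing here is a claim about the Yang–Mills mass gap

PDF held: `paper:balaban1988-cmp114-bij-abelian-higgs-effective-action` (journal page = PDF page + 256; p. 274 = PDF 18, text layer
`p0018.txt` + render re-read this session).

CITATION HEADER (lean-in-tree rule).  Part of the lit-balaban TYPED SKELETON (HOME `run/shared/lean/pub/lit-balaban/`), row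
**C2.Txt@274** of `HOME/lit-balaban-r18/ROWS-C2.md` (fold owner r18; unit `lit-balaban-r18`, gen 27; TAKING line HOME/STATUS.md
2026-08-23T11:49Z).  WHAT IS REPRODUCED, and how.  The gen-1 decl of record `BIJ88Sect4Statements.RegionTower` (p240556) types two of
the printed clauses — the α-monotonicity `Λ_{α+1}^{(j)} ⊆ Λ_α^{(j)}` and the cross-level inclusion `Λ_0^{(j)} ⊂ Λ_{13}^{(j−1)}` read through the
blocks of `Setup` — and the owner audit `HOME/lit-balaban-r18/AUDIT-C2S14-DEF-g26.md` (row C2.Txt@274) records what it does NOT type: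
*"X_ω disjoint unions of r(e_{k−1})-cubes"*, *"Λ_α^{(j)} … unions of r(e_j)-cubes"*, the collar prescription, and `Λ̄`.  THIS FILE types
them, WITH BODY, on the same carrier (the level-`i` tori `Balaban1983to89.Site P i` of `Setup`; print's "L^jη-lattice" = level `j`, the unit lattice
of step `k` = level `k`, "the L^{−1}-lattice" = level `k−1`), reusing BY NAME the tree's cube paving `BIJ88Assoc575Torus.cubeT r`
(the `r`-cubes `⌊x_μ/r⌋` of a torus, (5.7.5) p. 289), the sup torus distance `LatticeFieldCalculus.supDist`, the iterated block map
`BIJ85BlockAveragesTorusK.blkIter` / `blockK`, and `BIJ88NeumannNoZeroModesTorus.IsBlockUnion` (the regions `Ω` of the (2.31) files):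
(a) DEFINITIONS WITH BODIES: `IsRCubeUnion r Λ` (a union of `r`-cubes = saturated under `cubeT r`), `collar r Λ` / `collarShrink r Λ`
(the sites of `Λ` within sup-distance `r` of `Λᶜ` / `Λ` minus them = *"subtracting collar neighborhoods of width r"*), `barRegion n Λ`
(`Λ̄` = *"the union of L^n-blocks at the points of Λ"*), `LargeFieldFamily r X` (the `X_ω`: `r`-cube unions, pairwise disjoint),
`CoversCompl n Λα X` (`Λ_α^{(j)c} = ∪_ω (Λ_α^{(j)c} ∩ X_ω)`, read through blocks), and **`RegionTower274 r Λ`** = the five printed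
clauses (T1) cube unions for `α ≤ 13`, (T2) `Λ_{α+1}^{(j)} ⊆ Λ_α^{(j)}`, (T3) `j ≥ 1`, `α ∈ {1,…,8,11}`: `Λ_α^{(j)} = collarShrink r(e_j) Λ_{α−1}^{(j)}`,
(T5) `j ≥ 1`, `α ∈ {9,10}`: `Λ_α^{(j)}` = the collar-shrink of SOME `r(e_j)`-cube union `Λ̃ ⊆ Λ_{α−1}^{(j)}` (print: *"lose a collar from
Λ̃_8^{(j)}, Λ̃_9^{(j)}, which may be smaller"* — `Λ̃` is constructed in Sect. 5 and enters here existentially), (T4) `block y ⊆ Λ_{13}^{(j−1)}`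
for `y ∈ Λ_0^{(j)}`.  The integer cube sides `r j` stand for print's `r(e_j)` in level-`j` lattice units, rounded as on p. 263
(*"r(e_k)-cubes that can be built from cubes of size M"*); the step number `k` is implicit (levels beyond the printed range
`0 ≦ j ≦ k−1` are unconstrained by print and a user sets them to `univ`).  (b) PROVED (kernel theorems): `RegionTower274 → RegionTower`
(projection to the decl of record), antitonicity in `α`, `collarShrink ⊆`, `collarShrink = Λ ∖ collar`, **`isRCubeUnion_collarShrink`**:
on every torus whose side is a multiple of `r`, subtracting the width-`r` collar from an `r`-cube union leaves an `r`-cube union —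
the compatibility of (T1) with (T3) (one coordinate: a residue within circular distance `r` of a point of a foreign full `r`-cube is
within distance `r` of that cube from EVERY point of its own cube, `exists_sameCube_near`; the divisibility hypothesis is necessary —
with a truncated seam cube the statement fails), `isBlockUnion_barRegion` (`Λ̄` is a block union), `barRegion = ⋃ blockK`, and the
non-vacuity of `RegionTower274` (the constant tower `univ`).  (c) NOT asserted: any property of the ACTUAL regions of the expansion
(they are outputs of Sect. 5, r16's rows); the "compatibility conditions arising from our constructions" beyond the printed ones.
Kind: definitions with bodies + theorems; 0 `Prop`-valued facts (D-0026); `BIJ88Sect4Statements.RegionTower` untouched.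
-/

namespace Literature.MathematicalPhysics.QuantumFieldTheory.BalabanImbrieJaffe1984to88.BIJ88RegionTower274

open Literature.MathematicalPhysics.QuantumFieldTheory.Balaban1983to89
open LatticeFieldCalculus (supDist)
open B3TorusRadialSums (cdist cdist_le_supDist supDist_eq_sup_cdist cdist_le_val cdist_le_neg_val cdist_eq_zero_iff)
open BIJ85BlockAveragesTorusK (blkIter blockK mem_blockK)
open BIJ88NeumannNoZeroModesTorus (IsBlockUnion)
open BIJ88Assoc575Torus (cubeT val_cubeT)
open Finset

noncomputable section
open scoped Classical

variable {P : Params} {i : ℕ}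

/-! ## §1 One coordinate: cubes of side `r` on `ZMod N`, `r ∣ N` -/

section OneCoordinate

variable {N : ℕ} [NeZero N]

/-- kernel: `⌊A/r⌋·r ≤ A < ⌊A/r⌋·r + r`. [cite: Balaban1982Higgs1, (1.3) p.604] -/
private theorem div_mul_bounds (A : ℕ) {r : ℕ} (hr : 0 < r) : A / r * r ≤ A ∧ A < A / r * r + r := by
  have h1 := Nat.div_add_mod A r
  have h2 := Nat.mod_lt A hr
  rw [mul_comm] at h1
  omega

/-- kernel (one coordinate of `isRCubeUnion_collarShrink`): on `ZMod N` with `N = r·n`, cubes `⌊·/r⌋`; if `a, a′` lie in one cube and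
`b′` is within circular distance `r` of `a′`, then some `b` in the cube of `b′` is within circular distance `r` of `a`.
[cite: Balaban1982Higgs1, (1.3) p.604] -/
theorem exists_sameCube_near {r n : ℕ} (hN : N = r * n) (hr : 0 < r) (a a' b' : ZMod N)
    (hq : a'.val / r = a.val / r) (hd : cdist (a' - b') ≤ r) :
    ∃ b : ZMod N, b.val / r = b'.val / r ∧ cdist (a - b) ≤ r := by
  by_cases hqq : b'.val / r = a.val / r
  · refine ⟨a, hqq.symm, ?_⟩
    rw [sub_self, (cdist_eq_zero_iff (0 : ZMod N)).2 rfl]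
    exact Nat.zero_le _
  -- names and elementary bounds
  have hNpos : 0 < N := Nat.pos_of_ne_zero (NeZero.ne N)
  have hn : 1 ≤ n := by
    rcases Nat.eq_zero_or_pos n with h | h
    · rw [h, mul_zero] at hN; omega
    · exact h
  have hA := a.val_lt
  have hA' := a'.val_lt
  have hB' := b'.val_lt
  obtain ⟨hM1, hM2⟩ := div_mul_bounds a.val hr
  obtain ⟨hM1', hM2'⟩ := div_mul_bounds a'.val hr
  obtain ⟨hK1, hK2⟩ := div_mul_bounds b'.val hr
  rw [hq] at hM1' hM2'
  set q := a.val / r with hqdef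
  set q' := b'.val / r with hq'def
  have hNr : N - r = (n - 1) * r := by rw [hN, Nat.sub_mul, one_mul, mul_comm]
  have hrN : r ≤ N := by rw [hN]; exact Nat.le_mul_of_pos_right r hn
  -- the circular distance hypothesis, as a disjunction on the two orientations
  have hd' : (a' - b').val ≤ r ∨ (b' - a').val ≤ r := by
    have := min_le_iff.mp hd
    rwa [neg_sub] at this
  rcases hd' with h1 | h1
  · -- going DOWN from `a′` reaches `b′` within `r` steps
    rcases le_or_gt b'.val a'.val with hba | hba
    · -- no wrap: `A′ − B′ ≤ r`, the cube of `b′` is the cube just below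
      rw [ZMod.val_sub hba] at h1
      have hle : q' ≤ q := by rw [hq'def, ← hq]; exact Nat.div_le_div_right hba
      have hge : q - 1 ≤ q' := by
        rcases Nat.lt_or_ge a'.val r with hA'r | hA'r
        · have : q = 0 := by rw [← hq]; exact Nat.div_eq_of_lt hA'r
          rw [this, Nat.zero_sub]; exact Nat.zero_le _
        · have h3 : (a'.val - r * 1) / r = a'.val / r - 1 := Nat.sub_mul_div a'.val r 1
          rw [mul_one, hq] at h3
          rw [← h3, hq'def]
          exact Nat.div_le_div_right (by omega)
      have hq1 : q' = q - 1 ∧ 1 ≤ q := by omega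
      have hqr : r ≤ q * r := Nat.le_mul_of_pos_left r hq1.2
      refine ⟨((q * r - 1 : ℕ) : ZMod N), ?_, ?_⟩
      · rw [ZMod.val_cast_of_lt (by omega), hq1.1]
        refine Nat.div_eq_of_lt_le ?_ ?_
        · rw [Nat.sub_mul, one_mul]; omega
        · rw [Nat.sub_add_cancel hq1.2]; omega
      · refine (cdist_le_val _).trans ?_
        rw [ZMod.val_sub (by rw [ZMod.val_cast_of_lt (by omega)]; omega), ZMod.val_cast_of_lt (by omega)]
        omega
    · -- wrap through `0`: `A′ + N − B′ ≤ r`; then `a` lies in cube `0` and `b′` in the last cube `n − 1`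
      have hne : b' - a' ≠ 0 := by
        intro h; rw [sub_eq_zero] at h; rw [h] at hba; exact lt_irrefl _ hba
      have hv : (a' - b').val = N - (b'.val - a'.val) := by
        rw [← neg_sub, ZMod.neg_val, if_neg hne, ZMod.val_sub hba.le]
      rw [hv] at h1
      have hq0 : q = 0 := by rw [← hq]; exact Nat.div_eq_of_lt (by omega)
      have hAr : a.val < r := by
        have h4 := hM2
        rw [hq0, zero_mul, zero_add] at h4
        exact h4
      have hq'n : q' = n - 1 := by
        rw [hq'def]
        refine Nat.div_eq_of_lt_le ?_ ?_
        · rw [← hNr]; omega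
        · rw [Nat.sub_add_cancel hn, mul_comm, ← hN]; exact hB'
      have hn2 : 2 ≤ n := by
        by_contra h
        have : n = 1 := by omega
        exact hqq (by rw [hq'n, hq0]; omega)
      have hcast : ((N - 1 : ℕ) : ZMod N) = -1 := by
        rw [Nat.cast_sub (by omega : 1 ≤ N), Nat.cast_one, ZMod.natCast_self, zero_sub]
      refine ⟨((N - 1 : ℕ) : ZMod N), ?_, ?_⟩
      · rw [ZMod.val_cast_of_lt (by omega), hq'n]
        refine Nat.div_eq_of_lt_le ?_ ?_
        · rw [← hNr]; omega
        · rw [Nat.sub_add_cancel hn, mul_comm, ← hN]; omega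
      · refine (cdist_le_val _).trans ?_
        have ha1 : a - ((N - 1 : ℕ) : ZMod N) = ((a.val + 1 : ℕ) : ZMod N) := by
          rw [hcast, sub_neg_eq_add, Nat.cast_succ, ZMod.natCast_zmod_val]
        have hlt : a.val + 1 < N := by
          have : r * 2 ≤ r * n := Nat.mul_le_mul_left r hn2
          omega
        rw [ha1, ZMod.val_cast_of_lt hlt]
        omega
  · -- going UP from `a′` reaches `b′` within `r` steps
    rcases le_or_gt a'.val b'.val with hab | hab
    · -- no wrap: `B′ − A′ ≤ r`, the cube of `b′` is the cube just above
      rw [ZMod.val_sub hab] at h1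
      have hge : q ≤ q' := by rw [hq'def, ← hq]; exact Nat.div_le_div_right hab
      have hle : q' ≤ q + 1 := by
        have h3 : (a'.val + r) / r = a'.val / r + 1 := Nat.add_div_right a'.val hr
        rw [hq] at h3
        rw [← h3, hq'def]
        exact Nat.div_le_div_right (by omega)
      have hq1 : q' = q + 1 := by omega
      refine ⟨(((q + 1) * r : ℕ) : ZMod N), ?_, ?_⟩
      · have hlt : (q + 1) * r < N := by rw [← hq1]; omega
        rw [ZMod.val_cast_of_lt hlt, hq1]
        exact Nat.mul_div_cancel (q + 1) hr
      · refine (cdist_le_neg_val _).trans ?_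
        have hlt : (q + 1) * r < N := by rw [← hq1]; omega
        rw [neg_sub, ZMod.val_sub (by rw [ZMod.val_cast_of_lt hlt, add_one_mul]; omega), ZMod.val_cast_of_lt hlt, add_one_mul]
        omega
    · -- wrap through `0` upwards: `B′ + N − A′ ≤ r`; then `a` lies in the last cube and `b′` in cube `0`
      have hne : a' - b' ≠ 0 := by
        intro h; rw [sub_eq_zero] at h; rw [h] at hab; exact lt_irrefl _ hab
      have hv : (b' - a').val = N - (a'.val - b'.val) := by
        rw [← neg_sub, ZMod.neg_val, if_neg hne, ZMod.val_sub hab.le]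
      rw [hv] at h1
      have hq'0 : q' = 0 := by rw [hq'def]; exact Nat.div_eq_of_lt (by omega)
      have hqn : q = n - 1 := by
        rw [← hq]
        refine Nat.div_eq_of_lt_le ?_ ?_
        · rw [← hNr]; omega
        · rw [Nat.sub_add_cancel hn, mul_comm, ← hN]; exact hA'
      have hn2 : 2 ≤ n := by
        by_contra h
        have : n = 1 := by omega
        exact hqq (by rw [hq'0, hqn]; omega)
      refine ⟨0, ?_, ?_⟩
      · rw [ZMod.val_zero, Nat.zero_div, hq'0]
      · refine (cdist_le_neg_val _).trans ?_
        have ha0 : a ≠ 0 := by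
          intro h
          have : q = 0 := by rw [hqdef, h, ZMod.val_zero, Nat.zero_div]
          omega
        rw [sub_zero, ZMod.neg_val, if_neg ha0]
        have : q * r = N - r := by rw [hqn, hNr]
        omega

end OneCoordinate

/-! ## §2 `r`-cube unions and collars of width `r` on the level-`i` torus -/

/-- *"unions of r(e_j)-cubes of the L^jη-lattice"* (p. 274): `Λ ⊂ T^{(i)}` is a UNION OF `r`-CUBES iff it is saturated under the tree's
cube paving `cubeT r` (`⌊x_μ/r⌋` coordinatewise, [BIJ88Assoc575Torus]). [cite: BalabanImbrieJaffe1988, (4.1) p.274] -/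
def IsRCubeUnion (r : ℕ) (Λ : Finset (Balaban1983to89.Site P i)) : Prop :=
  ∀ x ∈ Λ, ∀ y : Balaban1983to89.Site P i, cubeT r y = cubeT r x → y ∈ Λ

/-- kernel: two sites lie in the same `r`-cube iff `⌊y_μ/r⌋ = ⌊x_μ/r⌋` for every `μ`. [cite: BalabanImbrieJaffe1988, (4.1) p.274] -/
theorem cubeT_eq_iff {r : ℕ} {x y : Balaban1983to89.Site P i} : cubeT r y = cubeT r x ↔ ∀ μ, (y μ).val / r = (x μ).val / r := by
  constructor
  · intro h μ
    have := congrArg (fun f => (f μ).val) h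
    simpa only [val_cubeT] using this
  · intro h
    funext μ
    simp only [cubeT, h μ]

/-- kernel: the whole torus is an `r`-cube union. [cite: BalabanImbrieJaffe1988, (4.1) p.274] -/
theorem isRCubeUnion_univ (r : ℕ) : IsRCubeUnion r (univ : Finset (Balaban1983to89.Site P i)) := fun _ _ y _ => mem_univ y

/-- kernel: the empty region is an `r`-cube union. [cite: BalabanImbrieJaffe1988, (4.1) p.274] -/
theorem isRCubeUnion_empty (r : ℕ) : IsRCubeUnion r (∅ : Finset (Balaban1983to89.Site P i)) := fun x hx => absurd hx (notMem_empty x)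

/-- kernel: the complement of an `r`-cube union is an `r`-cube union (print's `Λ_α^{(j)c}`). [cite: BalabanImbrieJaffe1988, (4.1) p.274] -/
theorem IsRCubeUnion.compl {r : ℕ} {Λ : Finset (Balaban1983to89.Site P i)} (h : IsRCubeUnion r Λ) : IsRCubeUnion r Λᶜ := by
  intro x hx y hyx
  rw [mem_compl] at hx ⊢
  exact fun hy => hx (h y hy x hyx.symm)

/-- The COLLAR OF WIDTH `r` of `Λ` (p. 274 *"collar neighborhoods of width r(e_j)"*): the sites of `Λ` within sup torus distance `r`
(`LatticeFieldCalculus.supDist`, lattice steps of the level-`i` torus) of the complement `Λᶜ`. [cite: BalabanImbrieJaffe1988, (4.1) p.274] -/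
def collar (r : ℕ) (Λ : Finset (Balaban1983to89.Site P i)) : Finset (Balaban1983to89.Site P i) :=
  Λ.filter fun x => ∃ y, y ∉ Λ ∧ supDist x y ≤ r

/-- *"subtracting collar neighborhoods of width r(e_j)"* (p. 274): `Λ` minus its collar of width `r` = the sites of `Λ` at sup torus
distance `> r` from every site of `Λᶜ`. [cite: BalabanImbrieJaffe1988, (4.1) p.274] -/
def collarShrink (r : ℕ) (Λ : Finset (Balaban1983to89.Site P i)) : Finset (Balaban1983to89.Site P i) :=
  Λ.filter fun x => ∀ y, y ∉ Λ → r < supDist x y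

/-- kernel: membership in the collar. [cite: BalabanImbrieJaffe1988, (4.1) p.274] -/
theorem mem_collar {r : ℕ} {Λ : Finset (Balaban1983to89.Site P i)} {x : Balaban1983to89.Site P i} :
    x ∈ collar r Λ ↔ x ∈ Λ ∧ ∃ y, y ∉ Λ ∧ supDist x y ≤ r := mem_filter

/-- kernel: membership in the shrunk region. [cite: BalabanImbrieJaffe1988, (4.1) p.274] -/
theorem mem_collarShrink {r : ℕ} {Λ : Finset (Balaban1983to89.Site P i)} {x : Balaban1983to89.Site P i} :
    x ∈ collarShrink r Λ ↔ x ∈ Λ ∧ ∀ y, y ∉ Λ → r < supDist x y := mem_filter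

/-- kernel: *"We have Λ_α^{(j)} ⊂ Λ_{α−1}^{(j)}"* — shrinking by a collar is a subset. [cite: BalabanImbrieJaffe1988, (4.1) p.274] -/
theorem collarShrink_subset (r : ℕ) (Λ : Finset (Balaban1983to89.Site P i)) : collarShrink r Λ ⊆ Λ := filter_subset _ _

/-- kernel: the collar lies in the region. [cite: BalabanImbrieJaffe1988, (4.1) p.274] -/
theorem collar_subset (r : ℕ) (Λ : Finset (Balaban1983to89.Site P i)) : collar r Λ ⊆ Λ := filter_subset _ _

/-- kernel: shrinking = *"subtracting"* the collar. [cite: BalabanImbrieJaffe1988, (4.1) p.274] -/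
theorem collarShrink_eq_sdiff (r : ℕ) (Λ : Finset (Balaban1983to89.Site P i)) : collarShrink r Λ = Λ \ collar r Λ := by
  ext x
  simp only [mem_collarShrink, mem_sdiff, mem_collar, not_and, not_exists, not_le]
  constructor
  · rintro ⟨hx, h⟩; exact ⟨hx, fun _ y hy => h y hy⟩
  · rintro ⟨hx, h⟩; exact ⟨hx, h hx⟩

/-- kernel: a wider collar shrinks more. [cite: BalabanImbrieJaffe1988, (4.1) p.274] -/
theorem collarShrink_mono_width {r r' : ℕ} (h : r ≤ r') (Λ : Finset (Balaban1983to89.Site P i)) : collarShrink r' Λ ⊆ collarShrink r Λ := by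
  intro x hx
  rw [mem_collarShrink] at hx ⊢
  exact ⟨hx.1, fun y hy => lt_of_le_of_lt h (hx.2 y hy)⟩

/-- kernel: the whole torus has no collar. [cite: BalabanImbrieJaffe1988, (4.1) p.274] -/
theorem collarShrink_univ (r : ℕ) : collarShrink r (univ : Finset (Balaban1983to89.Site P i)) = univ := by
  ext x
  simp only [mem_collarShrink, mem_univ, not_true_eq_false, false_implies, implies_true, and_self]

/-- **SUBTRACTING THE WIDTH-`r` COLLAR FROM AN `r`-CUBE UNION LEAVES AN `r`-CUBE UNION** — the compatibility of the two printed clauses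
*"unions of r(e_j)-cubes"* and *"determined by Λ_{α−1}^{(j)} by subtracting collar neighborhoods of width r(e_j)"* (p. 274), on every
torus of `Setup` whose side `2L^{m+K−i}` is a multiple of `r` (necessary: with a truncated seam cube the statement fails).
[cite: BalabanImbrieJaffe1988, (4.1) p.274] -/
theorem isRCubeUnion_collarShrink {r : ℕ} (hr : 0 < r) (hdiv : r ∣ P.sitesPerDir i) {Λ : Finset (Balaban1983to89.Site P i)}
    (hΛ : IsRCubeUnion r Λ) : IsRCubeUnion r (collarShrink r Λ) := by
  obtain ⟨n, hn⟩ := hdiv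
  intro x hx x' hxx'
  rw [mem_collarShrink] at hx ⊢
  obtain ⟨hxΛ, hfar⟩ := hx
  refine ⟨hΛ x hxΛ x' hxx', fun y' hy'Λ => ?_⟩
  by_contra hnear
  rw [not_lt] at hnear
  have hcube := cubeT_eq_iff.1 hxx'
  have hcd : ∀ μ, cdist (x' μ - y' μ) ≤ r := fun μ => (cdist_le_supDist x' y' μ).trans hnear
  choose c hc1 hc2 using fun μ => exists_sameCube_near hn hr (x μ) (x' μ) (y' μ) (hcube μ) (hcd μ)
  have hcy : cubeT r (c : Balaban1983to89.Site P i) = cubeT r y' := cubeT_eq_iff.2 hc1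
  have hcΛ : (c : Balaban1983to89.Site P i) ∉ Λ := fun h => hy'Λ (hΛ c h y' hcy.symm)
  have hdist : supDist x c ≤ r := by
    rw [supDist_eq_sup_cdist]
    exact Finset.sup_le fun μ _ => hc2 μ
  exact absurd (hfar c hcΛ) (not_lt.mpr hdist)

/-! ## §3 `Λ̄`: the union of `L^n`-blocks at the points of `Λ` -/

/-- *"We define Λ̄_α^{(j)} as the set … obtained as the union of L^j-blocks at the points of Λ_α^{(j)}"* (p. 274): for `Λ ⊂ T^{(i+n)}` the
fine sites of `T^{(i)}` whose `n`-fold block ancestor (`BIJ85BlockAveragesTorusK.blkIter n`) lies in `Λ`. [cite: BalabanImbrieJaffe1988, (4.1) p.274] -/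
def barRegion (n : ℕ) (Λ : Finset (Balaban1983to89.Site P (i + n))) : Finset (Balaban1983to89.Site P i) :=
  univ.filter fun x => blkIter n x ∈ Λ

/-- kernel: membership in `Λ̄`. [cite: BalabanImbrieJaffe1988, (4.1) p.274] -/
theorem mem_barRegion {n : ℕ} {Λ : Finset (Balaban1983to89.Site P (i + n))} {x : Balaban1983to89.Site P i} : x ∈ barRegion n Λ ↔ blkIter n x ∈ Λ := by
  simp only [barRegion, mem_filter, mem_univ, true_and]

/-- kernel: `Λ̄ = ⋃_{y ∈ Λ} B^n(y)` literally, with the tree's blocks `blockK n y`. [cite: BalabanImbrieJaffe1988, (4.1) p.274] -/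
theorem barRegion_eq_biUnion (n : ℕ) (Λ : Finset (Balaban1983to89.Site P (i + n))) : barRegion n Λ = Λ.biUnion (blockK n) := by
  ext x
  simp only [mem_barRegion, mem_biUnion, mem_blockK]
  constructor
  · intro h; exact ⟨_, h, rfl⟩
  · rintro ⟨y, hy, rfl⟩; exact hy

/-- kernel: `Λ̄` is a union of `n`-blocks in the sense of the (2.31) region files (`BIJ88NeumannNoZeroModesTorus.IsBlockUnion`).
[cite: BalabanImbrieJaffe1988, (4.1) p.274] -/
theorem isBlockUnion_barRegion (n : ℕ) (Λ : Finset (Balaban1983to89.Site P (i + n))) : IsBlockUnion n (barRegion n Λ) := by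
  intro x hx z hz
  rw [mem_barRegion] at hx ⊢
  rw [mem_blockK] at hz
  rwa [hz]

/-- kernel: `Λ̄` is monotone in `Λ`. [cite: BalabanImbrieJaffe1988, (4.1) p.274] -/
theorem barRegion_mono {n : ℕ} {Λ Λ' : Finset (Balaban1983to89.Site P (i + n))} (h : Λ ⊆ Λ') : barRegion n Λ ⊆ barRegion n Λ' := by
  intro x hx
  rw [mem_barRegion] at hx ⊢
  exact h hx

/-! ## §4 The large-field regions `X_ω` and the tower `Λ_α^{(j)}` -/

/-- *"Each X_ω is a union of r(e_{k−1})-cubes of the L^{−1}-lattice, and the X_ω's do not overlap"* (p. 274): a family of `r`-cube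
unions of one torus level, pairwise disjoint. [cite: BalabanImbrieJaffe1988, (4.1) p.274] -/
def LargeFieldFamily {ω : Type*} (r : ℕ) (X : ω → Finset (Balaban1983to89.Site P i)) : Prop :=
  (∀ w, IsRCubeUnion r (X w)) ∧ ∀ w w', w ≠ w' → Disjoint (X w) (X w')

/-- *"Each X_ω also specifies subsets Λ_α^{(j)} ∩ X_ω … with Λ_α^{(j)c} = ∪_ω (Λ_α^{(j)c} ∩ X_ω)"* (p. 274): the complement of the level-`i`
region `Λ_α` is COVERED by the `X_ω` (of level `i + n`), membership read through the `n`-fold block map. [cite: BalabanImbrieJaffe1988, (4.1) p.274] -/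
def CoversCompl {ω : Type*} (n : ℕ) (Λα : Finset (Balaban1983to89.Site P i)) (X : ω → Finset (Balaban1983to89.Site P (i + n))) : Prop :=
  ∀ x : Balaban1983to89.Site P i, x ∉ Λα → ∃ w, blkIter n x ∈ X w

/-- kernel: equivalently `Λ_αᶜ ⊆ ⋃_ω X̄_ω` with `X̄_ω = barRegion n (X ω)`. [cite: BalabanImbrieJaffe1988, (4.1) p.274] -/
theorem coversCompl_iff {ω : Type*} {n : ℕ} {Λα : Finset (Balaban1983to89.Site P i)} {X : ω → Finset (Balaban1983to89.Site P (i + n))} :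
    CoversCompl n Λα X ↔ ∀ x, x ∈ Λαᶜ → ∃ w, x ∈ barRegion n (X w) := by
  simp only [CoversCompl, mem_compl, mem_barRegion]

/-- The indices `α = 1, …, 8, 11` of p. 274 (*"the sets Λ_α^{(j)} are determined by Λ_{α−1}^{(j)} by subtracting collar neighborhoods
of width r(e_j)"*). [cite: BalabanImbrieJaffe1988, (4.1) p.274] -/
def collarSteps : Finset ℕ := {1, 2, 3, 4, 5, 6, 7, 8, 11}

/-- The indices `α = 9, 10` of p. 274 (*"The sets Λ_9^{(j)}, Λ_{10}^{(j)} lose a collar from Λ̃_8^{(j)}, Λ̃_9^{(j)}, which may be smaller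
than Λ_8^{(j)}, Λ_9^{(j)}"*). [cite: BalabanImbrieJaffe1988, (4.1) p.274] -/
def tildeSteps : Finset ℕ := {9, 10}

/-- **THE REGION TOWER OF p. 274 WITH ALL PRINTED CLAUSES.**  `Λ i α` = `Λ_α^{(i)}`, a finite set of sites of the level-`i` torus;
`r i` = the cube side `r(e_i)` in level-`i` lattice units.  (T1) *"These are unions of r(e_j)-cubes of the L^jη-lattice"* (`0 ≦ α ≦ 13`);
(T2) *"We have Λ_α^{(j)} ⊂ Λ_{α−1}^{(j)}"* (all `α`; for `α = 12, 13` this is the whole content: *"need not lose anything … though they may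
be smaller"*); (T3) *"For j ≧ 1, α = 1, …, 8, 11 the sets Λ_α^{(j)} are determined by Λ_{α−1}^{(j)} by subtracting collar neighborhoods of
width r(e_j)"*; (T5) *"The sets Λ_9^{(j)}, Λ_{10}^{(j)} lose a collar from Λ̃_8^{(j)}, Λ̃_9^{(j)}, which may be smaller than Λ_8^{(j)},
Λ_9^{(j)}"* (`Λ̃` enters existentially: an `r(e_j)`-cube union inside `Λ_{α−1}^{(j)}`); (T4) *"Λ_0^{(j)} ⊂ Λ_{13}^{(j−1)} for j ≧ 1"* read
through the blocks of `Setup` as in `BIJ88Sect4Statements.RegionTower`.  The case `j = 0` of (T3)/(T5) is Sect. 3's (*"covered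
already … slightly different"*). [cite: BalabanImbrieJaffe1988, (4.1) p.274] -/
def RegionTower274 (r : ℕ → ℕ) (Λ : (i : ℕ) → ℕ → Finset (Balaban1983to89.Site P i)) : Prop :=
  (∀ i α, α ≤ 13 → IsRCubeUnion (r i) (Λ i α)) ∧
  (∀ i α, Λ i (α + 1) ⊆ Λ i α) ∧
  (∀ i, 1 ≤ i → ∀ α ∈ collarSteps, Λ i α = collarShrink (r i) (Λ i (α - 1))) ∧
  (∀ i, 1 ≤ i → ∀ α ∈ tildeSteps,
      ∃ Λt : Finset (Balaban1983to89.Site P i), Λt ⊆ Λ i (α - 1) ∧ IsRCubeUnion (r i) Λt ∧ Λ i α = collarShrink (r i) Λt) ∧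
  (∀ i, ∀ y ∈ Λ (i + 1) 0, block y ⊆ Λ i 13)

namespace RegionTower274

variable {r : ℕ → ℕ} {Λ : (i : ℕ) → ℕ → Finset (Balaban1983to89.Site P i)}

/-- kernel: PROJECTION to the decl of record `BIJ88Sect4Statements.RegionTower` (p240556; clauses (T2), (T4)).
[cite: BalabanImbrieJaffe1988, (4.1) p.274] -/
theorem toRegionTower (h : RegionTower274 r Λ) : BIJ88Sect4Statements.RegionTower Λ := ⟨h.2.1, h.2.2.2.2⟩

/-- kernel: (T1). [cite: BalabanImbrieJaffe1988, (4.1) p.274] -/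
theorem isRCubeUnion (h : RegionTower274 r Λ) {i α : ℕ} (hα : α ≤ 13) : IsRCubeUnion (r i) (Λ i α) := h.1 i α hα

/-- kernel: the tower is antitone in `α`: `Λ_β^{(i)} ⊆ Λ_α^{(i)}` for `α ≤ β`. [cite: BalabanImbrieJaffe1988, (4.1) p.274] -/
theorem subset_of_le (h : RegionTower274 r Λ) {i α β : ℕ} (hαβ : α ≤ β) : Λ i β ⊆ Λ i α := by
  induction β, hαβ using Nat.le_induction with
  | base => exact subset_rfl
  | succ β _ ih => exact (h.2.1 i β).trans ih

/-- kernel: (T3) — for `j ≥ 1` and `α ∈ {1,…,8,11}` the region is the collar-shrink of the previous one. [cite: BalabanImbrieJaffe1988, (4.1) p.274] -/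
theorem eq_collarShrink (h : RegionTower274 r Λ) {i : ℕ} (hi : 1 ≤ i) {α : ℕ} (hα : α ∈ collarSteps) :
    Λ i α = collarShrink (r i) (Λ i (α - 1)) := h.2.2.1 i hi α hα

/-- kernel: (T5) — for `j ≥ 1` and `α ∈ {9,10}` the region is the collar-shrink of some cube union `Λ̃ ⊆ Λ_{α−1}^{(j)}`.
[cite: BalabanImbrieJaffe1988, (4.1) p.274] -/
theorem exists_tilde (h : RegionTower274 r Λ) {i : ℕ} (hi : 1 ≤ i) {α : ℕ} (hα : α ∈ tildeSteps) :
    ∃ Λt : Finset (Balaban1983to89.Site P i), Λt ⊆ Λ i (α - 1) ∧ IsRCubeUnion (r i) Λt ∧ Λ i α = collarShrink (r i) Λt := h.2.2.2.1 i hi α hα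

/-- kernel: (T4) — every block of a site of `Λ_0^{(j+1)}` lies in `Λ_{13}^{(j)}`; with `barRegion`: `Λ̄_0^{(j+1)}` (one level down) `⊆ Λ_{13}^{(j)}`.
[cite: BalabanImbrieJaffe1988, (4.1) p.274] -/
theorem block_subset (h : RegionTower274 r Λ) (i : ℕ) {y : Balaban1983to89.Site P (i + 1)} (hy : y ∈ Λ (i + 1) 0) : block y ⊆ Λ i 13 :=
  h.2.2.2.2 i y hy

/-- kernel: along the collar steps of a level `j ≥ 1` the sites of `Λ_α^{(j)}` are MORE than `r(e_j)` away from `(Λ_{α−1}^{(j)})ᶜ`.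
[cite: BalabanImbrieJaffe1988, (4.1) p.274] -/
theorem far_from_compl (h : RegionTower274 r Λ) {i : ℕ} (hi : 1 ≤ i) {α : ℕ} (hα : α ∈ collarSteps) {x : Balaban1983to89.Site P i}
    (hx : x ∈ Λ i α) {y : Balaban1983to89.Site P i} (hy : y ∉ Λ i (α - 1)) : r i < supDist x y := by
  rw [h.eq_collarShrink hi hα, mem_collarShrink] at hx
  exact hx.2 y hy

end RegionTower274

/-- NON-VACUITY: the constant tower `Λ_α^{(j)} = T^{(j)}` (no large fields anywhere) satisfies every clause, for any cube sides.
[cite: BalabanImbrieJaffe1988, (4.1) p.274] -/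
theorem regionTower274_univ (r : ℕ → ℕ) : RegionTower274 (P := P) r fun i _ => (univ : Finset (Balaban1983to89.Site P i)) := by
  refine ⟨fun i α _ => isRCubeUnion_univ (r i), fun _ _ => subset_rfl, fun i _ α _ => (collarShrink_univ (r i)).symm,
    fun i _ α _ => ⟨univ, subset_rfl, isRCubeUnion_univ (r i), (collarShrink_univ (r i)).symm⟩, fun i y _ => subset_univ _⟩

/-- NON-VACUITY of the cube-union / collar clauses away from the trivial tower: at a level whose side is a multiple of `r`, the
sequence `Λ, shrink Λ, shrink² Λ, …` started from ANY `r`-cube union consists of `r`-cube unions, each inside the previous one —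
(T1)–(T3) at one level. [cite: BalabanImbrieJaffe1988, (4.1) p.274] -/
theorem isRCubeUnion_iterate_collarShrink {r : ℕ} (hr : 0 < r) (hdiv : r ∣ P.sitesPerDir i) {Λ : Finset (Balaban1983to89.Site P i)}
    (hΛ : IsRCubeUnion r Λ) (α : ℕ) :
    IsRCubeUnion r ((collarShrink r)^[α] Λ) ∧ (collarShrink r)^[α + 1] Λ ⊆ (collarShrink r)^[α] Λ := by
  induction α with
  | zero => exact ⟨hΛ, collarShrink_subset r Λ⟩
  | succ α ih =>
    refine ⟨?_, ?_⟩
    · rw [Function.iterate_succ_apply']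
      exact isRCubeUnion_collarShrink hr hdiv ih.1
    · rw [Function.iterate_succ_apply', Function.iterate_succ_apply']
      exact collarShrink_subset r _

end

end Literature.MathematicalPhysics.QuantumFieldTheory.BalabanImbrieJaffe1984to88.BIJ88RegionTower274
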